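import Mathlib
import Literature.AlgebraicGeometry.Resolution.CobordantChartCoefficients

/-!
# The coefficient-tuple game of a prepared hypersurface germ (maximal contact for tame multiplicities)

Folklore infrastructure for the crux `LocalWeightedDrop` of route ResolutionOfSingularities/WeightedInvariant
(item stmt-ResolutionOfSingularities-8899), line `hasse-ridge-face-selection`.

A formal hypersurface germ of order `d = e + 2` whose multiplicity is invertible in the ground field admits, after a
formal coordinate change, the TSCHIRNHAUS (maximal contact) form
`F = U · y^{e+2} + Σ_{j ≤ e} a_j(x') · y^j` (`U` a unit, no `y^{e+1}` term; `y` the distinguished last variable,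
`x' = (x_0, …, x_{m-1})`): Abhyankar's Tschirnhausen transformation / Hironaka's hypersurface of maximal contact
`∂^{(d-1)}_y F = 0`, which exists in characteristic `p` exactly when `p ∤ d` (Giraud; Narasimhan's examples for
`p ∣ d`).  The COEFFICIENT TUPLE `a = (a_0, …, a_e)` with the MARKINGS `d - j` is Hironaka's coefficient ideal
`(a_j, d - j)_j` of `F` on the maximal contact hypersurface `y = 0` (Hironaka 1964; Villamayor 1989; Bierstone–Milman
1997 §4; Kollár, *Lectures on Resolution of Singularities* (2007) §3.4; Abramovich–Temkin–Włodarczyk,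
arXiv:1906.07106 §5 for the weighted centre `(y^{1/1}, x'^{1/w})` read off the first two invariants).

This file records the induced game on coefficient tuples in the chart vocabulary of the tree's local weighted
resolution game (`CobordantChart.chart`, `CobordantGame`): a move is a legal coordinate change `Φ` of the `x'`
variables and weights `w ∈ {0,1}^m ∖ 0` (a smooth centre inside `y = 0`); the distinguished variable receives the
FLOOR WEIGHT `W = ⌊min_j D_j / (d - j)⌋` (`D_j` the `w`-order of `a_j∘Φ`), so that the weighted cobordant blow-up of
`F` along `(Φ ⊗ id, (w, W))` has `s`-saturated transform `U'·(c + y)^{e+2} + Σ_j s^{D_j - (d-j)W} G_j (c + y)^j` at an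
exceptional point; at the points of order `d` again (`c = 0`) the shape reproduces with the SUCCESSOR TUPLE
`(s^{D_j - (d-j)W} G_j)|_{y_i' = 0}` (`newTuple`).  `Drop k m e` — "the tuple game in `m` variables for order `e + 2`
is won": one ordinal rank on tuples drops at every bad successor — is the order reduction of the marked coefficient
ideal in dimension `m` in positional form.

* `marking e j = e + 2 - j`, `Bad a` (every entry vanishes to order ≥ its marking ⇔ the prepared germ has order
  `e + 2`), `germ U a` (the prepared germ), `slice i` (the crux's coordinate slice `y_i' ↦ 0`), `floorWeight`,
  `newTuple`, `StepDrop κ P a` (one move from `a` after which `κ` drops and `P` holds at every bad successor),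
  `Drop k m e`, `prodSupport a` (the product of the non-zero entries, whose normal-crossing-ness governs the plane
  strategy), and the arithmetic of the floor weight (`marking_mul_floorWeight_le`,
  `exists_lt_marking_mul_floorWeight_succ`).

Design: plain definitions over an arbitrary field `k : Type` with the quantifier shapes of `CobordantGame` /
`PlaneGermNonNCCount`, so that the lift theorem ("`Drop k m e` + all singular germs of smaller order won ⇒ the prepared
germ is won", Summits side) and the plane case `Drop k 2 e` (Summits side) can be stated by name.  Junk values,
documented: `marking` is written `j.rev + 2` (no truncated subtraction); `floorWeight` of the zero tuple is `0`
(infimum over an empty index type in `ℕ`); the exponent `D_j - marking_j · W` in `newTuple` is a natural-number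
subtraction which never truncates when `D, G` are the actual factorisation data (`marking_mul_floorWeight_le`).
Deliberately NOT here: any theorem about the game (the lift, the plane strategy), and the Tschirnhaus preparation
itself.
-/

namespace Literature.AlgebraicGeometry.Resolution.TupleGame

open MvPowerSeries

variable {k : Type} [Field k]

/-- The MARKING of slot `j` of the coefficient tuple of a prepared germ of order `e + 2`: the coefficient `a_j` of
`y^j` is weighted by `e + 2 - j` (written `j.rev + 2` to avoid truncated subtraction; Hironaka's coefficient ideal
`(a_j, d - j)`). [folklore] -/
def marking (e : ℕ) (j : Fin (e + 1)) : ℕ := (j.rev : ℕ) + 2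

/-- `marking e j = e + 2 - j`. [folklore] -/
theorem marking_eq (e : ℕ) (j : Fin (e + 1)) : marking e j = e + 2 - (j : ℕ) := by
  unfold marking
  rw [Fin.val_rev]
  omega

/-- `marking e j + j = e + 2`. [folklore] -/
theorem marking_add_val (e : ℕ) (j : Fin (e + 1)) : marking e j + (j : ℕ) = e + 2 := by
  unfold marking
  rw [Fin.val_rev]
  omega

/-- Markings are at least `2`. [folklore] -/
theorem two_le_marking (e : ℕ) (j : Fin (e + 1)) : 2 ≤ marking e j := by
  unfold marking
  omega

/-- Markings are positive. [folklore] -/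
theorem marking_pos (e : ℕ) (j : Fin (e + 1)) : 0 < marking e j :=
  lt_of_lt_of_le two_pos (two_le_marking e j)

/-- A coefficient tuple is BAD when every entry vanishes to order at least its marking — equivalently the prepared
germ `U·y^{e+2} + Σ a_j y^j` still has order `e + 2` (the marked coefficient ideal has order `≥ 1`). [folklore] -/
def Bad {m e : ℕ} (a : Fin (e + 1) → MvPowerSeries (Fin m) k) : Prop :=
  ∀ j, a j = 0 ∨ ((marking e j : ℕ) : ℕ∞) ≤ (a j).order

/-- The PREPARED GERM of a unit `U` and a coefficient tuple `a`: `U · y^{e+2} + Σ_{j ≤ e} a_j(x') · y^j`, the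
entries renamed into the first `m` slots along `Fin.succAbove (Fin.last m)` and `y = X (Fin.last m)` the
distinguished last variable; no `y^{e+1}` term (Tschirnhaus / maximal-contact form). [folklore] -/
noncomputable def germ {m e : ℕ} (U : MvPowerSeries (Fin (m + 1)) k)
    (a : Fin (e + 1) → MvPowerSeries (Fin m) k) : MvPowerSeries (Fin (m + 1)) k :=
  U * X (Fin.last m) ^ (e + 2) +
    ∑ j : Fin (e + 1), rename (Fin.succAboveEmb (Fin.last m)) (a j) * X (Fin.last m) ^ (j : ℕ)

/-- The coordinate SLICE `y_i' ↦ 0` of a series in the chart variables `(s, y_0', …, y_{m-1}')` of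
`CobordantChart.chart` (`s = X 0`, `y_i' = X i.succ`), the remaining variables re-indexed by `Fin.predAbove i` — the
spelling used by `PlaneGermNonNCCount` and the crux's tame slice; at an exceptional point with `c_i ≠ 0` it is the
classical strict-transform chart `x_i = c_i s`. [folklore] -/
noncomputable def slice {m : ℕ} (i : Fin m) (G : MvPowerSeries (Fin (m + 1)) k) : MvPowerSeries (Fin m) k :=
  subst (fun j : Fin (m + 1) => if j = i.succ then (0 : MvPowerSeries (Fin m) k) else X (Fin.predAbove i j)) G

/-- The FLOOR WEIGHT of the distinguished variable for given `s`-orders `D_j` of the entries: the infimum over the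
non-zero entries of `D_j / marking_j`, i.e. `⌊min_j D_j / (e + 2 - j)⌋`, the largest `W` with
`marking_j · W ≤ D_j` for every non-zero entry (`0` for the zero tuple: empty infimum in `ℕ`). [folklore] -/
noncomputable def floorWeight {m e : ℕ} (a : Fin (e + 1) → MvPowerSeries (Fin m) k) (D : Fin (e + 1) → ℕ) : ℕ :=
  ⨅ j : {j : Fin (e + 1) // a j ≠ 0}, D j.1 / marking e j.1

/-- `marking_j · W ≤ D_j` for every non-zero entry `j` (`W` the floor weight). [folklore] -/
theorem marking_mul_floorWeight_le {m e : ℕ} {a : Fin (e + 1) → MvPowerSeries (Fin m) k} (D : Fin (e + 1) → ℕ)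
    {j : Fin (e + 1)} (hj : a j ≠ 0) : marking e j * floorWeight a D ≤ D j := by
  have hle : floorWeight a D ≤ D j / marking e j := by
    unfold floorWeight
    exact ciInf_le (OrderBot.bddBelow _) (⟨j, hj⟩ : {j : Fin (e + 1) // a j ≠ 0})
  calc marking e j * floorWeight a D ≤ marking e j * (D j / marking e j) := Nat.mul_le_mul_left _ hle
    _ ≤ D j := Nat.mul_div_le (D j) (marking e j)

/-- For a non-zero tuple the floor weight is attained: some non-zero entry has `D_j < marking_j · (W + 1)`.
[folklore] -/
theorem exists_lt_marking_mul_floorWeight_succ {m e : ℕ} {a : Fin (e + 1) → MvPowerSeries (Fin m) k} (ha : a ≠ 0)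
    (D : Fin (e + 1) → ℕ) : ∃ j, a j ≠ 0 ∧ D j < marking e j * (floorWeight a D + 1) := by
  obtain ⟨j₀, hj₀⟩ : ∃ j, a j ≠ 0 := by
    by_contra h
    push Not at h
    exact ha (funext h)
  haveI : Nonempty {j : Fin (e + 1) // a j ≠ 0} := ⟨⟨j₀, hj₀⟩⟩
  obtain ⟨⟨j, hj⟩, hjeq⟩ := ciInf_mem (fun j : {j : Fin (e + 1) // a j ≠ 0} => D j.1 / marking e j.1)
  refine ⟨j, hj, ?_⟩
  have hW : floorWeight a D = D j / marking e j := by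
    unfold floorWeight
    exact hjeq.symm
  rw [hW, Nat.mul_add, mul_one]
  have hpos := marking_pos e j
  have := Nat.div_add_mod (D j) (marking e j)
  have hmod := Nat.mod_lt (D j) hpos
  omega

open scoped Classical in
/-- The SUCCESSOR TUPLE at an exceptional point, sliced at the slot `i`: entry `j` is the slice `y_i' ↦ 0` of
`s^{D_j - marking_j · W} · G_j` (`W` the floor weight; the exponent never truncates by
`marking_mul_floorWeight_le`), and `0` where `a_j = 0`. [folklore] -/
noncomputable def newTuple {m e : ℕ} (a : Fin (e + 1) → MvPowerSeries (Fin m) k) (D : Fin (e + 1) → ℕ)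
    (G : Fin (e + 1) → MvPowerSeries (Fin (m + 1)) k) (i : Fin m) : Fin (e + 1) → MvPowerSeries (Fin m) k :=
  fun j => if a j = 0 then 0 else slice i (X 0 ^ (D j - marking e j * floorWeight a D) * G j)

/-- ONE STEP OF THE TUPLE GAME FROM `a` DROPS `κ` AND PROPAGATES `P`: there is a move — a legal coordinate change
`Φ` of the `m` variables (zero constant terms, invertible linear part) and weights `w ∈ {0,1}^m` with some `w_i = 1`
(a smooth centre) — such that at every exceptional point `c ≠ 0` (with `c_i = 0` on the weight-`0` slots), for the
factorisation data `a_j∘Φ(chart) = s^{D_j} · G_j`, `s ∤ G_j` of the non-zero entries, some slot `i` with `c_i ≠ 0`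
has: if the successor tuple sliced at `i` is non-zero and bad, then it satisfies `P` and has smaller `κ`.
[folklore] -/
def StepDrop {m e : ℕ} (κ : (Fin (e + 1) → MvPowerSeries (Fin m) k) → Ordinal.{0})
    (P : (Fin (e + 1) → MvPowerSeries (Fin m) k) → Prop) (a : Fin (e + 1) → MvPowerSeries (Fin m) k) : Prop :=
  ∃ (Φ : Fin m → MvPowerSeries (Fin m) k) (w : Fin m → ℕ),
    (∀ i, constantCoeff (Φ i) = 0) ∧
    IsUnit (Matrix.det (Matrix.of fun i j => coeff (Finsupp.single j 1) (Φ i))) ∧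
    (∀ i, w i ≤ 1) ∧ (∃ i, 0 < w i) ∧
    ∀ c : Fin m → k, (∀ i, w i = 0 → c i = 0) → c ≠ 0 →
      ∀ (D : Fin (e + 1) → ℕ) (G : Fin (e + 1) → MvPowerSeries (Fin (m + 1)) k),
        (∀ j, a j ≠ 0 →
          subst (CobordantChart.chart w c) (subst Φ (a j)) = X 0 ^ D j * G j ∧ ¬ X 0 ∣ G j) →
        ∃ i, c i ≠ 0 ∧ (newTuple a D G i ≠ 0 → Bad (newTuple a D G i) →
          P (newTuple a D G i) ∧ κ (newTuple a D G i) < κ a)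

/-- THE TUPLE GAME IN `m` VARIABLES FOR ORDER `e + 2` IS WON: one ordinal rank `κ` on coefficient tuples such that
from every non-zero bad tuple some move makes `κ` drop at every non-zero bad successor (order reduction of the
marked coefficient ideal in dimension `m`, positional form). [folklore] -/
def Drop (k : Type) [Field k] (m e : ℕ) : Prop :=
  ∃ κ : (Fin (e + 1) → MvPowerSeries (Fin m) k) → Ordinal.{0},
    ∀ a : Fin (e + 1) → MvPowerSeries (Fin m) k, a ≠ 0 → Bad a → StepDrop κ (fun _ => True) a

open scoped Classical in
/-- The PRODUCT OF THE NON-ZERO ENTRIES of a tuple (zero entries replaced by `1`): the plane strategy first makes its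
support a normal crossing. [folklore] -/
noncomputable def prodSupport {m e : ℕ} (a : Fin (e + 1) → MvPowerSeries (Fin m) k) : MvPowerSeries (Fin m) k :=
  ∏ j, if a j = 0 then 1 else a j

/-- The product of the non-zero entries is non-zero (`k[[x]]` is a domain). [folklore] -/
theorem prodSupport_ne_zero {m e : ℕ} (a : Fin (e + 1) → MvPowerSeries (Fin m) k) : prodSupport a ≠ 0 := by
  classical
  unfold prodSupport
  refine Finset.prod_ne_zero_iff.mpr fun j _ => ?_
  split_ifs with h
  · exact one_ne_zero
  · exact h

end Literature.AlgebraicGeometry.Resolution.TupleGame
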